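import Summits.Ventures.Crystal3D.Theorems.StickyWulffConstantGenericWallFloorStarFarForms
import HarnessLib

/-!
# Kernel discharge of `StarPairFar`, part 3: the branch-and-bound procedures (computable; evaluated by
# `native_decide` in the task files)

HONEST FRAMING. Venture `Summits/Ventures/Crystal3D` (cell `crystal3d-full`), helper `--supports` the crux
`GenericWallFloor` (stmt-Ventures-19480) of `route-Ventures-StickyWulffConstant`, line `WallLedgerG`.  Rung credit only;
F-C1 not moved.  Milestone 3 of the kernel discharge of `StarPairFar` (R1): the SELF-RECOMPUTING interval branch and
bound of wulff-p2 g10's lineage-B′ certifier `starfar.py` (kit j298800: 2048/2048 tasks, 35 896 q-boxes, 4.7 M Y-boxes),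
re-typed as total Lean functions over `ℤ` (no certificate data are imported: the search is re-run by evaluation).

* scale `SC = 2³²` for quaternion and eleventh-ball coordinates; parameters `DQMIN = 9`, `DQMAX = 45`, `YB0 = 2000`,
  `YDEPTH = 60`, `YD0 = 15`, `YDSTEP = 2` (verbatim);
* precomputed form tables `pairForms`, `certQForms`, `movForms`, `cyForms`, `fixVecs` (closed terms, built from the landed
  data through part 2);
* `qBasic` (PAIR / CERTQ discharge of a q-box), `YCtx`/`mkCtx` (the q-box enclosures handed to the Y-level), `yClosed`
  (SPHERE / FIX / MOV / CERTY discharge of a Y-box), `ySearch` (depth-first bisection of the longest side with a threaded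
  node budget; `none` = give the q-box back), `qSearch` (q-level bisection of the widest free coordinate), `topBox` (the
  `4 × 8³` top task boxes: chart coordinate fixed at `SC`, the other three in eighths of `[−SC, SC]`), `checkTask`.
One deviation from `starfar.py`, on the safe side: the MOV test uses the exact corner bound of each product
`(N Fⱼ)_a · Y_a` over `[lo, hi] × [c − h, c + h]` (`prodLo`) instead of the midpoint/radius bound.
WHAT THIS IS NOT: the soundness theorems (part 4), the evaluation (task files), `StarPairFar` (final file).
-/

namespace Summit.Ventures.Crystal3D.Theorems.StarFar

open Summit.Ventures.Crystal3D.Theorems.NearIdentity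

/-! ### Parameters and precomputed tables -/

/-- Common scale of all coordinates: the box integer `t` stands for the real number `t / SC`. -/
def SC : ℤ := 2 ^ 32

/-- q-bisections (beyond the top box) before any Y-search. -/
def DQMIN : ℕ := 9
/-- q-bisections beyond which a box FAILS. -/
def DQMAX : ℕ := 45
/-- Y-node budget at q-depth `DQMIN` (doubles per extra q-bisection, capped at `2²²`). -/
def YB0 : ℕ := 2000
/-- absolute cap on Y-bisections. -/
def YDEPTH : ℕ := 60
/-- Y-bisections allowed at q-depth `DQMIN` … -/
def YD0 : ℕ := 15
/-- … plus this many per extra q-bisection. -/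
def YDSTEP : ℕ := 2

/-- All ordered pairs of star indices. -/
def starPairs : List (Fin 13 × Fin 13) := starList.flatMap fun i => starList.map fun j => (i, j)

/-- The 25 pair forms `(i, j, A_ij, C_ij)`. -/
def pairForms : List (Fin 13 × Fin 13 × QF4 × QF4) :=
  starPairs.map fun p => (p.1, p.2, pairA p.1 p.2, pairC p.1 p.2)

/-- The forms `E_c` of the certificates WITHOUT eleventh ball (`useY = false`). -/
def certQForms : List QF4 := (starDtCerts.filter fun c => !c.useY).map certE

/-- The forms `E_c` and data `(y₀, Kn)` of the certificates WITH eleventh ball (`useY = true`). -/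
def cyForms : List (QF4 × ℤ × ℤ × ℤ × ℤ) :=
  (starDtCerts.filter fun c => c.useY).map fun c =>
    (certE c, (c.y0 0).num, (c.y0 1).num, (c.y0 2).num, c.Ktot.num)

/-- The moving-cage component forms `(j, (N Fⱼ)₀, (N Fⱼ)₁, (N Fⱼ)₂)`. -/
def movForms : List (Fin 13 × QF4 × QF4 × QF4) := starList.map fun j => (j, movF j 0, movF j 1, movF j 2)

/-- The fixed star balls `(i, Fᵢ)`. -/
def fixVecs : List (Fin 13 × ℤ × ℤ × ℤ) := starList.map fun i => (i, FZ i 0, FZ i 1, FZ i 2)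

/-! ### q-level discharge -/

/-- PAIR / CERTQ discharge of a q-box: some pair form has `A_ij > 0` and `C_ij > 0` on the box (hypothesis h1★ fails
there), or some `useY = false` certificate has `E_c < 0` on the box (its ball contains every rotation of the box). -/
def qBasic (B : Box4) : Bool :=
  pairForms.any (fun p => decide (0 < p.2.2.1.lo B) && decide (0 < p.2.2.2.lo B)) ||
    certQForms.any (fun E => decide (E.hi B < 0))

/-! ### Y-level -/

/-- Enclosure of the three components of `N(q) Fⱼ` over a q-box. -/
structure MovR where
  j : Fin 13
  l0 : ℤ
  u0 : ℤ
  l1 : ℤ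
  u1 : ℤ
  l2 : ℤ
  u2 : ℤ

/-- Y-level datum of a `useY` certificate over a q-box: `U ≥ max E_c`, `y₀` (× `√2`), `Kn`. -/
structure CyR where
  U : ℤ
  y0 : ℤ
  y1 : ℤ
  y2 : ℤ
  kn : ℤ

/-- What the Y-level knows about the current q-box. -/
structure YCtx where
  nhi : ℤ
  mov : List MovR
  cy : List CyR

/-- The Y-level context of a q-box (all enclosures by part 1). -/
def mkCtx (B : Box4) : YCtx where
  nhi := B.sqHi
  mov := movForms.map fun m =>
    ⟨m.1, m.2.1.lo B, m.2.1.hi B, m.2.2.1.lo B, m.2.2.1.hi B, m.2.2.2.lo B, m.2.2.2.hi B⟩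
  cy := cyForms.map fun r => ⟨r.1.hi B, r.2.1, r.2.2.1, r.2.2.2.1, r.2.2.2.2⟩

/-- SPHERE test: `|Y|² = 2` is impossible in the box. -/
def ySphere (Y : Box3) : Bool := decide (2 * SC * SC < Y.sqLo) || decide (Y.sqHi < 2 * SC * SC)

/-- FIX test: `Y ⬝ Fᵢ > 1` on the box for some star ball (hypothesis h3★ fails there). -/
def yFix (Y : Box3) : Bool := fixVecs.any fun f => decide (SC < Y.linLo f.2.1 f.2.2.1 f.2.2.2)

/-- MOV test: `Y ⬝ (N Fⱼ) > |q|²` on q-box × Y-box for some star ball (hypothesis h4★ fails there). -/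
def yMov (ctx : YCtx) (Y : Box3) : Bool :=
  ctx.mov.any fun m =>
    decide (ctx.nhi * SC < prodLo m.l0 m.u0 Y.c0 Y.h0 + prodLo m.l1 m.u1 Y.c1 Y.h1 + prodLo m.l2 m.u2 Y.c2 Y.h2)

/-- CERTY test: the ball of some `useY` certificate contains q-box × Y-box. -/
def yCert (ctx : YCtx) (Y : Box3) : Bool :=
  ctx.cy.any fun r =>
    decide (r.U * (SC * SC) + 3 * r.kn *
      (sqHi (Y.c0 - SC * r.y0) Y.h0 + sqHi (Y.c1 - SC * r.y1) Y.h1 + sqHi (Y.c2 - SC * r.y2) Y.h2) * ctx.nhi < 0)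

/-- A Y-box is discharged by one of the four tests. -/
def yClosed (ctx : YCtx) (Y : Box3) : Bool := ySphere Y || yFix Y || yMov ctx Y || yCert ctx Y

/-- The longest side of a Y-box (ties: lowest index). -/
def Box3.longAxis (Y : Box3) : Fin 3 :=
  if Y.h1 > Y.h0 then (if Y.h2 > Y.h1 then 2 else 1) else (if Y.h2 > Y.h0 then 2 else 0)

/-- Depth-first Y-search with `fuel` further bisections allowed and a threaded node `budget`; returns the remaining
budget if every Y-box below `Y` is discharged, `none` otherwise (then the q-box is handed back for bisection). -/
def ySearch (ctx : YCtx) : ℕ → Box3 → ℕ → Option ℕ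
  | 0, Y, budget => if budget = 0 then none else if yClosed ctx Y then some (budget - 1) else none
  | fuel + 1, Y, budget =>
    if budget = 0 then none else
    if yClosed ctx Y then some (budget - 1) else
    let a := Y.longAxis
    if Y.hw a % 2 = 0 then
      match ySearch ctx fuel (Y.split a).2 (budget - 1) with
      | none => none
      | some b => ySearch ctx fuel (Y.split a).1 b
    else none

/-- The root Y-box `[−3/2, 3/2]³` (× `SC`); it contains the sphere `|Y|² = 2`. -/
def rootY : Box3 := ⟨0, 0, 0, 3 * 2 ^ 31, 3 * 2 ^ 31, 3 * 2 ^ 31⟩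

/-- The Y-level verdict on a q-box at q-depth `d`. -/
def yLevel (B : Box4) (d : ℕ) : Bool :=
  (ySearch (mkCtx B) (min YDEPTH (YD0 + YDSTEP * (d - DQMIN))) rootY (min (YB0 * 2 ^ (d - DQMIN)) (2 ^ 22))).isSome

/-! ### q-level search and the tasks -/

/-- The widest coordinate of a q-box (ties: lowest index; the chart coordinate has width `0`). -/
def Box4.longAxis (B : Box4) : Fin 4 :=
  let a : Fin 4 := if B.h1 > B.h0 then 1 else 0
  let a : Fin 4 := if B.h2 > B.hw a then 2 else a
  if B.h3 > B.hw a then 3 else a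

/-- q-level search: discharge by `qBasic`, else (from depth `DQMIN` on) by the Y-level, else bisect the widest
coordinate (`fuel` further bisections allowed). -/
def qSearch : ℕ → Box4 → ℕ → Bool
  | 0, B, d => qBasic B || (decide (DQMIN ≤ d) && yLevel B d)
  | fuel + 1, B, d =>
    qBasic B || (decide (DQMIN ≤ d) && yLevel B d) ||
      (let a := B.longAxis
       decide (B.hw a % 2 = 0) && (qSearch fuel (B.split a).2 (d + 1) && qSearch fuel (B.split a).1 (d + 1)))

/-- Centre of the `i`-th eighth of `[−SC, SC]`. -/
def topC (i : Fin 8) : ℤ := -SC + (2 * (i : ℤ) + 1) * (SC / 8)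

/-- The top box of task `(chart, i, j, k)`: chart coordinate fixed at `SC` (width `0`), the others eighths of `[−SC, SC]`. -/
def topBox : Fin 4 → Fin 8 → Fin 8 → Fin 8 → Box4
  | 0, i, j, k => ⟨SC, topC i, topC j, topC k, 0, SC / 8, SC / 8, SC / 8⟩
  | 1, i, j, k => ⟨topC i, SC, topC j, topC k, SC / 8, 0, SC / 8, SC / 8⟩
  | 2, i, j, k => ⟨topC i, topC j, SC, topC k, SC / 8, SC / 8, 0, SC / 8⟩
  | 3, i, j, k => ⟨topC i, topC j, topC k, SC, SC / 8, SC / 8, SC / 8, 0⟩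

/-- A task: a chart and three eighth indices. -/
abbrev Task := Fin 4 × Fin 8 × Fin 8 × Fin 8

/-- **The check of one task**: the whole branch and bound below its top box succeeds. -/
def checkTask (t : Task) : Bool := qSearch DQMAX (topBox t.1 t.2.1 t.2.2.1 t.2.2.2) 0

/-- All `2048` tasks. -/
def allTasks : List Task :=
  (List.finRange 4).flatMap fun c => (List.finRange 8).flatMap fun i =>
    (List.finRange 8).flatMap fun j => (List.finRange 8).map fun k => (c, i, j, k)

/-- The tasks of chart `c` whose first eighth index is `i` (`64` tasks; the unit of the task files). -/
def taskBlock (c : Fin 4) (i : Fin 8) : List Task :=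
  (List.finRange 8).flatMap fun j => (List.finRange 8).map fun k => (c, i, j, k)

end Summit.Ventures.Crystal3D.Theorems.StarFar
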